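import Literature.NumberTheory.Automorphic.ClozelCArithmeticProofs
import HarnessLib

/-!
# `IrreducibilityBySelfDuality.HeckeEigenvalueField`, the case `n = 1`, PROVED
(item stmt-Langlands-13632, support, rank 1; `--supports` file, theorems only, Theses-free)

The input item `HeckeEigenvalueField` is Clozel 1990, Thm. 3.13 in Hecke-eigenvalue form, for all
`n` and all number fields `K` (= the named fact `Clozel1990_heckeEigenvalueField`). Its `n = 1`
slice is Weil's theorem (1956) on the values of algebraic Hecke characters, a THEOREM of the tree
on the item's own carriers (`Literature.NumberTheory.Automorphic.Clozel1990_heckeEigenvalueField.rank_one`,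
file `ClozelCArithmeticProofs.lean`: Hecke character of a `GL₁` datum, its algebraicity for
C-algebraic `π`, unramifiedness, Satake parameter `{χ_π(ϖ_v)}`, Weil's number field). This module
records the `n = 1` slice of the ITEM'S TEXT (verbatim, `n := 1`; `heckeEigenvalueOf` unfolded as in
the route file) as proved — the part of the item that is a theorem today; `n ≥ 2` is Clozel's
cohomological argument, absent from the tree.
-/

namespace Summit.Langlands.Langlands.Theorems.HeckeEigenvalueField

open Filter Literature.NumberTheory.Automorphic

/-- **The `n = 1` slice of the input item `IrreducibilityBySelfDuality.HeckeEigenvalueField`,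
proved** (text verbatim with `n := 1`): for `π` cuspidal regular algebraic on `GL₁(𝔸_K)`, `K` any
number field, one number field `E ⊂ ℂ` contains `(√q_v)^{i(1-i)} e_i(α)` for `i ≤ 1` and every
Satake parameter `α` of `π` at all but finitely many `v` (in fact at every unramified `v`).
Clozel 1990, Thm. 3.13 for `n = 1` = Weil 1956, §1 (`Clozel1990_heckeEigenvalueField.rank_one`).
[cite: Clozel1990, Thm. 3.13 (n = 1)] -/
theorem heckeEigenvalueField_rank_one :
    ∀ (K : Type) [Field K] [NumberField K] (hcpt : _)
      (π : Literature.NumberTheory.Automorphic.CuspidalAutomorphicRepData 1 K hcpt),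
      π.1.IsRegularAlgebraic → ∃ E : Subfield ℂ, FiniteDimensional ℚ E ∧ ∀ᶠ v in cofinite,
        ∀ α : Multiset ℂ, π.1.HasSatakeParamAt v α → ∀ i ≤ 1,
          ((((Real.sqrt (v.residueCard : ℝ)) : ℝ) : ℂ) ^ (i * (1 - i))) * α.esymm i ∈ E :=
  Clozel1990_heckeEigenvalueField.rank_one

end Summit.Langlands.Langlands.Theorems.HeckeEigenvalueField
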